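import Literature.NumberTheory.Automorphic.CDTTheorem712
import Literature.NumberTheory.Automorphic.BCDTTheoremBWildAtThreeDet
import Literature.NumberTheory.EllipticCurves.ModFiveCongruenceHesseFamily
import Literature.NumberTheory.EllipticCurves.VariableChangePointsMap
import Literature.NumberTheory.EllipticCurves.WeilPairingProofs
import Literature.NumberTheory.EllipticCurves.DivisionField
import Literature.NumberTheory.EllipticCurves.GoodReductionUnramifiedProofs
import Literature.NumberTheory.EllipticCurves.MultiplicativeUnramifiedTorsionProofs
import Literature.NumberTheory.GaloisRepresentations.AbsGaloisGroup
import Literature.NumberTheory.GaloisRepresentations.QuadraticInertia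
import Literature.NumberTheory.DiophantineGeometry.LocalReductionProofs
import Literature.NumberTheory.EllipticCurves.ModPIrreducibleCongruenceTransferProofs
import Summits.ABC.ABC.Theorems.DefiniteXiFreyModularityStubAbsIrrNegThreeGroup
import Summits.ABC.ABC.Theorems.DefiniteXiFreyModularityCDT
import HarnessLib

/-!
# STUB-IDEAS `stub_switch` — ideator k3 · FAMILY 3 (probe the extremes) · GENERATION 8 — Lean companion

Target (fixed): `Summit.ABC.ABC.Cruxes.FreyModularity.Sketch.stub_switch`
(`↔ Literature.NumberTheory.Automorphic.BCDT.CDT_three_five_switch`, `Iff.rfl`, §5).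
Road unchanged since g4: `stub_switch ⇐ thm132(i) + Core1728 + tail` (`stub_switch_of_core_and_tail`,
PROVED in g4, consumes `Core1728` only POINTWISE at the integral model of `W`).

## THE GEN-8 MOVE — TORSOR RIGIDITY (push the IMAGE parameter to its extreme)

g3–g7 obtain the `τ`-fixed good root `t₁` of `𝔠₆(c₄,c₆;·,1)` (= `Core1728At`) by READING Hesse
parameters off Fisher 13.2 **(ii)** (`Thm132iiMemHesseFamily`, the deep half: needs the
obstruction theory `X_E(5) →` pencil).  Gen 8 removes (ii) on the extreme `ρ̄_{W,5} ⊇ SL₂(𝔽₅)`: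

* `Φ := SympIso(E_d[5], W[5])` (`E_d : y² = x³ + dx`, `d ∈ {1, 9, −3}` from the g3 trichotomy) has
  `120` elements and `Γ_ℚ` acts on it.  For a GOOD ROOT `t₁` (`𝔠₆(t₁,1)=0 ≠ 𝔠₄(t₁,1)`) and `w` with
  `d·w⁴ = −27𝔠₄(t₁,1)` the member `E_{t₁,1} : y² = x³ − 27𝔠₄(t₁,1)x` is `K`-isomorphic to `E_d`,
  `K = ℚ(t₁,w)`, so Fisher 13.2 (direction ⇐, over the NUMBER FIELD `K` — verbatim in scope:
  "perfect field of characteristic not dividing `6n`") gives a symplectic `e : E_d[5] ≃ W[5]` with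
  `Stab(t₁,w) ≤ eqvSubgroup e`                                              — named fact R1.
* COUNT: `|Γ·(t₁,w)| ≤ 30·4 = 120` (roots of `𝔠₆(·,1)` × fourth roots)        — ORB (S).
* BIG (regime): `Γ_{ℚ(E_d[5])} ↠ Sp(W[5]) ≅ SL₂(𝔽₅)` ⇒ `index(eqvSubgroup e) ≥ 120` — IDX (S), so
  the INDEX PINCH `Stab(t₁,w) = eqvSubgroup e` holds (PINCH, PROVED): the `1728`-fibre of `X_W(5)`
  IS the torsor `Φ`, and Fisher (ii) at `j = 1728` becomes a COROLLARY of (i) by counting.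
* FIX (g3 `haux` + g5 G4a, all typed before, decide parts PROVED): `τ = τ₀¹⁵`, `d`, symplectic `e₀`
  with `τ ∈ eqvSubgroup e₀`; TRANS (S, from BIG + W1): `e₀ = γ ∘ e`, `γ|_{E_d[5]} = 1`; CONJ (PROVED):
  `eqvSubgroup e₀ = γ·(eqvSubgroup e)·γ⁻¹ = Stab(γt₁, γw)` ∋ `τ` ⇒ `τ` fixes the good root `γ•t₁`.
  `core1728At_of_rigidity` (§3) is KERNEL-CHECKED from the named helpers.
* PRICE of dropping (ii): ROOT (a good root exists; M−: chart identity `17424𝔠₄ = 121𝔇_λ² − 132𝔇𝔇_λλ`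
  at `μ = 1` + `Res_T(𝔇, 𝔠₄) = κ(c₄³−c₆²)⁴⁴` [kit j345070, symbolic] — or vendor Klein).
* BOUNDARY (the other extreme, where rigidity provably FAILS): transitivity needs `5 ∣ #ρ̄_{W,5}(Γ)`;
  kit j345070: `𝔠₆(T,1)` is IRREDUCIBLE of degree `30` for `37a1, 43a1, 14a1, y²=x(x−1)(x+8)`
  (surjective `ρ̄₅`) and factors `[6,12,12]` for `36a1, 27a1, 49a1` (CM, `5 ∤ #G`), `[2,4,8,8,8]` for
  `11a1` (Borel).  There (ii)/`Split1728` (g7 Lane A) stays load-bearing.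

WARNING: this file re-declares g3–g7 names in its own namespace `StubSwitchK3g8` (standalone check).
-/

set_option linter.dupNamespace false

noncomputable section

open scoped Classical NumberField Pointwise NNReal

namespace Summit.ABC.ABC.Cruxes.FreyModularity.StubSwitchK3g8

open Literature.NumberTheory.EllipticCurves Literature.NumberTheory.EllipticCurves.HesseFamilyFive
open Literature.NumberTheory.Automorphic Literature.NumberTheory.GaloisRepresentations
open Literature.NumberTheory.Automorphic.BCDT
open WeierstrassCurve IsDedekindDomain Field NumberField IsDedekindDomain.HeightOneSpectrum

universe u

/-! ## §0 Context (verbatim g3/g4/g5/g7) -/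

/-- The member `E_{λ,μ}` of Fisher's direct Hesse family. -/
abbrev member (c₄ c₆ l m : ℚ) : WeierstrassCurve ℚ :=
  ⟨0, 0, 0, -27 * C4 c₄ c₆ l m, -54 * C6 c₄ c₆ l m⟩

/-- The `c₄c₆`-model `y² = x³ − 27c₄x − 54c₆`. -/
abbrev base (c₄ c₆ : ℚ) : WeierstrassCurve ℚ := ⟨0, 0, 0, -27 * c₄, -54 * c₆⟩

/-- `E₁ : y² = x³ + x` (`j = 1728`, conductor `64`, good at `3`). -/
abbrev E₁ : WeierstrassCurve ℚ := ⟨0, 0, 0, 1, 0⟩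

instance : E₁.IsElliptic :=
  ⟨isUnit_iff_ne_zero.mpr (by norm_num [E₁, WeierstrassCurve.Δ, WeierstrassCurve.b₂,
    WeierstrassCurve.b₄, WeierstrassCurve.b₆, WeierstrassCurve.b₈])⟩

/-- NEW NAME, old objects: `E_d : y² = x³ + dx` (`j = 1728`, CM by `ℤ[i]`); `E₁ = Ed 1`, g3's
`E₉ = Ed 9`, `E₋₃ = Ed (-3)` (the three shapes of the g3 `σ¹⁵`-trichotomy). -/
abbrev Ed (d : ℚ) : WeierstrassCurve ℚ := ⟨0, 0, 0, d, 0⟩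

/-- The gen-3/4 CORE (verbatim g4/g5/g7). -/
def Core1728 : Prop :=
  ∀ (c₄ c₆ : ℤ), c₄ ^ 3 ≠ c₆ ^ 2 → c₆ ≠ 0 →
    ∃ (τ : Field.absoluteGaloisGroup ℚ) (t₁ : AlgebraicClosure ℚ),
      (∀ s : AlgebraicClosure ℚ, s ^ 2 = -3 → τ • s = -s) ∧
      (∀ z : AlgebraicClosure ℚ, z ^ 4 = 1 → τ • z = z) ∧
      C6 (c₄ : AlgebraicClosure ℚ) c₆ t₁ 1 = 0 ∧ C4 (c₄ : AlgebraicClosure ℚ) c₆ t₁ 1 ≠ 0 ∧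
      τ • t₁ = t₁

/-- The pointwise conclusion of `Core1728` (verbatim g7). -/
def Core1728At (c₄ c₆ : ℤ) : Prop :=
  ∃ (τ : Field.absoluteGaloisGroup ℚ) (t₁ : AlgebraicClosure ℚ),
    (∀ s : AlgebraicClosure ℚ, s ^ 2 = -3 → τ • s = -s) ∧
    (∀ z : AlgebraicClosure ℚ, z ^ 4 = 1 → τ • z = z) ∧
    C6 (c₄ : AlgebraicClosure ℚ) c₆ t₁ 1 = 0 ∧ C4 (c₄ : AlgebraicClosure ℚ) c₆ t₁ 1 ≠ 0 ∧ τ • t₁ = t₁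

theorem core1728_iff : Core1728 ↔ ∀ c₄ c₆ : ℤ, c₄ ^ 3 ≠ c₆ ^ 2 → c₆ ≠ 0 → Core1728At c₄ c₆ :=
  Iff.rfl

/-- The equivariance subgroup of an additive iso `e : E'[5] ≃ E[5]` (verbatim g4). -/
def eqvSubgroup {E E' : WeierstrassCurve ℚ} (e : E'.geomTorsion 5 ≃+ E.geomTorsion 5) :
    Subgroup (Field.absoluteGaloisGroup ℚ) where
  carrier := {γ | ∀ P : E'.geomTorsion 5, e (γ • P) = γ • e P}
  one_mem' := fun P => by rw [one_smul, one_smul]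
  mul_mem' := fun {a b} ha hb P => by
    simp only [Set.mem_setOf_eq] at ha hb
    rw [mul_smul, ha, hb, mul_smul]
  inv_mem' := fun {a} ha P => by
    simp only [Set.mem_setOf_eq] at ha
    have h := ha (a⁻¹ • P)
    rw [smul_inv_smul] at h
    rw [h, inv_smul_smul]

theorem mem_eqvSubgroup_iff {E E' : WeierstrassCurve ℚ} (e : E'.geomTorsion 5 ≃+ E.geomTorsion 5)
    (γ : Field.absoluteGaloisGroup ℚ) :
    γ ∈ eqvSubgroup e ↔ ∀ P : E'.geomTorsion 5, e (γ • P) = γ • e P :=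
  Iff.rfl

/-- "`e : E'[5] ≃ E[5]` respects the Weil pairings" (the predicate g4–g7 spell out inline). -/
def IsSymplectic {E E' : WeierstrassCurve ℚ} [E.IsElliptic] [E'.IsElliptic]
    (e : E'.geomTorsion 5 ≃+ E.geomTorsion 5) : Prop :=
  ∀ P Q : E'.geomTorsion 5,
    weilPairingFun (W := E) (m := 5) (by norm_num) (e P : E.geomPoints) (e Q) =
      weilPairingFun (W := E') (m := 5) (by norm_num) (P : E'.geomPoints) Q

/-! ## §1 Inherited machinery, packaged (everything here was typed in g3/g5; decide parts PROVED) -/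

/-- **FIX (packaged; = the `haux` block of g3 `exists_fixed_root_1728` followed by g5 G4a).**
Atoms: T0 `exists_inertial_elt` (S; g5/g6 FL2 form), `pow_odd_smul` (PROVED g3),
`det_frame_eq_one` (PROVED g3, tree `det_eq_modPCyclotomicCharacter_of_isTorsionGaloisRep_holds` — this
is where `det ρ̄_{W,5} = χ̄₅` is USED, honouring `Negative.stub_switch_false_without_det`),
`gl_pow_fifteen_trichotomy` / `gl_conj_of_sq_eq_neg_one` / `exists_gl_det_eq` (PROVED g3, `decide`),
`frame_eq_one/_neg_one/_sq_eq_neg_one` (PROVED g3), T1 `smul_torsion_E₉` / T2 `smul_smul_torsion_Em₃`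
(S, g5 via TW+NEG), G4a `exists_symplectic_equivariant_at` (PROVED g5 mod W1 (S), W2 (XS), W3a (XS),
W3c (S)).  Output: `τ := τ₀¹⁵` negates `√-3`, fixes `μ₄` (indeed `μ₂₀`), and for the `d ∈ {1,9,−3}`
matching the shape of `ρ̄_W(τ)` there is a SYMPLECTIC `e₀ : E_d[5] ≃ W[5]` equivariant at `τ`.
[SilvermanAEC2009 VII.4.1, III.8.1; Fisher2012Hessian Def 13.1] -/
theorem exists_aux_fixed (c₄ c₆ : ℤ) [(base (c₄ : ℚ) c₆).IsElliptic] :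
    ∃ (τ : Field.absoluteGaloisGroup ℚ) (d : ℚ) (_ : (Ed d).IsElliptic),
      (d = 1 ∨ d = 9 ∨ d = -3) ∧
      (∀ s : AlgebraicClosure ℚ, s ^ 2 = -3 → τ • s = -s) ∧
      (∀ z : AlgebraicClosure ℚ, z ^ 4 = 1 → τ • z = z) ∧
      ∃ e₀ : (Ed d).geomTorsion 5 ≃+ (base (c₄ : ℚ) c₆).geomTorsion 5,
        IsSymplectic e₀ ∧ τ ∈ eqvSubgroup e₀ := by
  sorry

/-! ## §2 The new helpers of generation 8 -/

/-- **R1 — named fact `Thm132iRootFibre` (Fisher 13.2, direction ⇐, over the number field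
`K = ℚ(t₁, w) ⊂ ℚ̄`).**  VERBATIM SPECIAL CASE: [Fisher2012Hessian, Thm 13.2 (PLMS 104 (2012) 613–648 =
arXiv:math/0610403, §13 p.19; standing hypothesis §2 p.4 "perfect field `K` of characteristic not
dividing `6n`", here `char K = 0`, `n = 5`)]: for `E = base(c₄,c₆)` (defined over `ℚ ⊆ K`) and
`(λ, μ) = (t₁, 1) ∈ K²`, "an elliptic curve `E'` over `K` isomorphic over `K` to `E_{λ,μ}` is directly
`5`-congruent to `E`" [Def 13.1: a `Gal(K̄/K)`-equivariant isomorphism `E'[5] ≅ E[5]` respecting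
`e₅`].  We take `E' = E_d` (over `ℚ ⊆ K`), which is `K`-isomorphic to
`E_{t₁,1} : y² = x³ − 27𝔠₄(t₁,1)x` (`𝔠₆(t₁,1) = 0`; non-singular as `𝔠₄(t₁,1) ≠ 0`) by
`(x,y) ↦ (w²x, w³y)`, because `d·w⁴ = −27𝔠₄(t₁,1)` [SilvermanAEC2009 III §1 Table 3.1, `u = w⁻¹`];
and `Gal(ℚ̄/K) = {σ : σt₁ = t₁ ∧ σw = w}`.  (The tree's `thm132_geomTorsionFive_of_hesseFamily` is the
same theorem over `K = ℚ`; (ii) = `Thm132iiMemHesseFamily` is NOT used in generation 8.)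
[Fisher2012Hessian Thm 13.2; RubinSilverberg1995 Thm 4.1] -/
def Thm132iRootFibre : Prop :=
  ∀ (c₄ c₆ : ℤ) (d : ℚ) [(base (c₄ : ℚ) c₆).IsElliptic] [(Ed d).IsElliptic]
    (t₁ w : AlgebraicClosure ℚ),
    C6 (c₄ : AlgebraicClosure ℚ) c₆ t₁ 1 = 0 → C4 (c₄ : AlgebraicClosure ℚ) c₆ t₁ 1 ≠ 0 →
    (d : AlgebraicClosure ℚ) * w ^ 4 = -27 * C4 (c₄ : AlgebraicClosure ℚ) c₆ t₁ 1 →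
    ∃ e : (Ed d).geomTorsion 5 ≃+ (base (c₄ : ℚ) c₆).geomTorsion 5,
      IsSymplectic e ∧
      ∀ σ : Field.absoluteGaloisGroup ℚ, σ • t₁ = t₁ → σ • w = w → σ ∈ eqvSubgroup e

/-- **R2 — the REGIME hypothesis `SL2Onto c₄ c₆ d`**: under any frame `ρ̄` of `W[5]`
(`W = base(c₄,c₆)`), every matrix of determinant `1` is realised by a Galois element acting
TRIVIALLY on `E_d[5]`; i.e. `Γ_{ℚ(E_d[5])} ↠ Sp(W[5]) ≅ SL₂(𝔽₅)`.  Discharged from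
"`ρ̄_{W,5}(Γ_ℚ) ⊇ SL₂(𝔽₅)`" by `sl2Onto_of_hasSL2` below; FALSE in the small-image regime
(`5 ∤ #ρ̄_{W,5}(Γ)`: CM, normaliser-of-Cartan, `S₄`; e.g. `36a1`, kit j345070). -/
def SL2Onto (c₄ c₆ : ℤ) (d : ℚ) : Prop :=
  ∀ ρ : ModPGaloisRep ℚ (ZMod 5) 2, (base (c₄ : ℚ) c₆).IsTorsionGaloisRep 5 ρ →
    ∀ M : GL (Fin 2) (ZMod 5), Matrix.GeneralLinearGroup.det M = 1 →
      ∃ γ : Field.absoluteGaloisGroup ℚ, (∀ P : (Ed d).geomTorsion 5, γ • P = P) ∧ ρ γ = M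

/-- "`ρ̄_{W,5}(Γ_ℚ) ⊇ SL₂(𝔽₅)`" for `W = base(c₄,c₆)` (frame-independent since `SL₂ ⊴ GL₂`). -/
def HasSL2 (c₄ c₆ : ℤ) : Prop :=
  ∀ ρ : ModPGaloisRep ℚ (ZMod 5) 2, (base (c₄ : ℚ) c₆).IsTorsionGaloisRep 5 ρ →
    ∀ M : GL (Fin 2) (ZMod 5), Matrix.GeneralLinearGroup.det M = 1 →
      ∃ γ : Field.absoluteGaloisGroup ℚ, ρ γ = M

/-- **R2′ (M): `HasSL2 → SL2Onto` for the three CM shapes.**  Recipe (the "8th-power trick", no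
structure theory of `SL₂(𝔽₅)`): (a) AUT — `E_d` has the automorphism `[i] : (x,y) ↦ (−x, iy)`;
as in g5 TW, `σ ∘ [i] = [i]^{±1} ∘ σ` on `E_d(ℚ̄)`, so in a frame `ρ̄_{E_d}(σ) J = J^{±1} ρ̄_{E_d}(σ)`
with `J² = −1`, `J ≠ ±1` (S); (b) EXP8 — `decide` cert over `M₂(𝔽₅)`:
`J*J = -1 → J ≠ 2 → J ≠ 3 → (B*J = J*B ∨ B*J = -(J*B)) → IsUnit (det B) → B^8 = 1`, hence
`γ⁸ ∈ Γ_{ℚ(E_d[5])}` for every `γ`; (c) every element of order `5` of `SL₂(𝔽₅)` is an `8`th power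
(`u = (u²)⁸`), and GEN — `decide`/BFS cert: the transvections `!![1,1;0,1]`, `!![1,0;1,1]` generate
`SL₂(𝔽₅)` (closure has `120` elements); the realisable matrices form a subgroup (image of the subgroup
`Γ_{ℚ(E_d[5])}`), so it is all of `SL₂(𝔽₅)`.  [Serre1972 §4.5 (CM image in `N(C_s)` at a split prime);
Dickson; folklore] -/
theorem sl2Onto_of_hasSL2 (c₄ c₆ : ℤ) (d : ℚ) [(Ed d).IsElliptic] (h : HasSL2 c₄ c₆) :
    SL2Onto c₄ c₆ d := by
  sorry

/-- **R2″ (S + decide): a usable source of `HasSL2`** — an IRREDUCIBLE `ρ̄_{W,5}` whose image contains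
an element of order `5` (a transvection) contains `SL₂(𝔽₅)` [Dickson; Serre1972 Prop. 15]: `decide`
cert "two transvections with distinct centres generate `SL₂(𝔽₅)`", and if all transvections of the
image share a centre the image fixes that line (reducible).  At the ROUTE call site (Frey curves,
case B) an order-`5` element is supplied by Tate inertia at any odd `p ∣ abc` with `5 ∤ v_p(Δ_min)`
(tree: multiplicative unramified-torsion criterion); it is ABSENT exactly on the quintic-Fermat shapes
`v_p(abc) ≡ 0 (5) ∀ odd p` — the honest boundary of this lane. -/
theorem hasSL2_of_irreducible_of_order_five (c₄ c₆ : ℤ) [(base (c₄ : ℚ) c₆).IsElliptic]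
    (ρ : ModPGaloisRep ℚ (ZMod 5) 2) (hρ : (base (c₄ : ℚ) c₆).IsTorsionGaloisRep 5 ρ)
    (hirr : FramedRep.IsIrreducible ρ)
    (h5 : ∃ γ : Field.absoluteGaloisGroup ℚ, ρ γ ≠ 1 ∧ (ρ γ) ^ 5 = 1) : HasSL2 c₄ c₆ := by
  sorry

/-- **ROOT-a (chart identity, PROVED by `ring`)**: at `μ = 1`,
`17424·𝔠₄ = 121·𝔇_λ² − 132·𝔇·𝔇_λλ` (Euler relations for the degree-`12` form `𝔇`).  Hence at a root
of `𝔇(·,1)`: `𝔠₄ = 𝔇_λ²/144`, so a COMMON root of `𝔠₄(·,1)` and `𝔇(·,1)` is a MULTIPLE root of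
`𝔇(·,1)`. [Fisher2012Hessian §8 (c4def); elementary] -/
theorem C4_chart_identity {F : Type*} [Field F] [CharZero F] (a b t : F) :
    (17424 : F) * C4 a b t 1 = 121 * Dl a b t 1 ^ 2 - 132 * D a b t 1 * Dll a b t 1 := by
  have h : (17424 : F) ≠ 0 := by norm_num
  simp only [C4]
  rw [mul_div_cancel₀ _ h]
  simp only [Dll, Dmm, Dlm, Dl, D]
  ring

/-- **ROOT (M−): a GOOD ROOT exists** — some root `t₁ ∈ ℚ̄` of `𝔠₆(c₄,c₆;·,1)` has `𝔠₄(t₁,1) ≠ 0`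
(`c₆ ≠ 0`, `c₄³ ≠ c₆²`).  This is the price of dropping Fisher (ii) (g3–g7 got the good root from
(ii): `E₁` non-singular ⇒ parameters off the cusps).  Recipe: `𝔠₆(·,1)` has degree `30` (leading
coefficient `c₆`, cf. `C6_one_zero`) hence a root (`IsAlgClosed.exists_root`); if `𝔠₄(t₁,1) = 0` too
then `𝔇(t₁,1) = 0` (tree syzygy `𝔠₄³ − 𝔠₆² = (c₄³−c₆²)𝔇⁵`) and `𝔇_λ(t₁,1) = 0` (`C4_chart_identity`),
a multiple root of `𝔇(·,1)`; but `𝔇(·,1)` and `𝔠₄(·,1)` are COPRIME off `c₄³ = c₆²`: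
`Res_T(𝔇(T,1), 17424·𝔠₄(T,1)) = κ·(c₄³−c₆²)⁴⁴`, `disc_T 𝔇(T,1) = κ'·(c₄³−c₆²)²²` (kit j345070,
symbolic in `ℤ[c₄,c₆]`); in Lean: Bézout cofactors after the weight normalisation
`𝔇(a²,a³r;T,1) = a¹²𝔇(1,r;T/a,1)` (one parameter `r`, `linear_combination`), or VENDOR Klein's
disjointness of vertices/face-centres/edge-midpoints of the icosahedron [Klein1884; Fisher2012Hessian
§7 (roots of `D`, `c₄`, `c₆`), Remark 8.6]. -/
theorem exists_goodRoot (c₄ c₆ : ℤ) (hc : c₄ ^ 3 ≠ c₆ ^ 2) (h6 : c₆ ≠ 0) :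
    ∃ t₁ : AlgebraicClosure ℚ, C6 (c₄ : AlgebraicClosure ℚ) c₆ t₁ 1 = 0 ∧
      C4 (c₄ : AlgebraicClosure ℚ) c₆ t₁ 1 ≠ 0 := by
  sorry

/-- **GOODROOT transport (S−)**: `σ ∈ Γ_ℚ` maps good roots to good roots (`𝔠₄, 𝔠₆ ∈ ℚ[c₄,c₆][λ,μ]`;
`map_C4`/`map_C6` for the ring hom `σ`, as g5 `map_N4_N6`; `σ` fixes `ℤ`-casts and `1`). -/
theorem goodRoot_smul {c₄ c₆ : ℤ} {t : AlgebraicClosure ℚ} (σ : Field.absoluteGaloisGroup ℚ)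
    (h6 : C6 (c₄ : AlgebraicClosure ℚ) c₆ t 1 = 0) (h4 : C4 (c₄ : AlgebraicClosure ℚ) c₆ t 1 ≠ 0) :
    C6 (c₄ : AlgebraicClosure ℚ) c₆ (σ • t) 1 = 0 ∧ C4 (c₄ : AlgebraicClosure ℚ) c₆ (σ • t) 1 ≠ 0 := by
  sorry

/-- **ORB (S): the orbit count** — the `Γ_ℚ`-orbit of `(t₁, w)` lies in the finite set
`{(t, w') : p(t) = 0 ∧ d·w'⁴ = −27𝔠₄(t,1)}`, `p := 𝔠₆(c₄,c₆;X,1) ∈ ℚ[X]` of `natDegree ≤ 30`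
(`p ≠ 0`: coefficient of `X³⁰` is `c₆`), at most `4` fourth roots per `t` (`d ≠ 0`): so the
stabiliser has finite index `≤ 120` (`MulAction.orbitEquivQuotientStabilizer`, `Subgroup.index`,
`Set.ncard_le_ncard`, `Polynomial.card_roots'`, `goodRoot_smul`-type map lemmas). [folklore] -/
theorem index_stabilizer_pair_le {c₄ c₆ : ℤ} {d : ℚ} (hd : d ≠ 0) (h6 : c₆ ≠ 0)
    {t₁ w : AlgebraicClosure ℚ} (ht : C6 (c₄ : AlgebraicClosure ℚ) c₆ t₁ 1 = 0)
    (hw : (d : AlgebraicClosure ℚ) * w ^ 4 = -27 * C4 (c₄ : AlgebraicClosure ℚ) c₆ t₁ 1) :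
    (MulAction.stabilizer (Field.absoluteGaloisGroup ℚ)
        ((t₁, w) : AlgebraicClosure ℚ × AlgebraicClosure ℚ)).index ≠ 0 ∧
    (MulAction.stabilizer (Field.absoluteGaloisGroup ℚ)
        ((t₁, w) : AlgebraicClosure ℚ × AlgebraicClosure ℚ)).index ≤ 120 := by
  sorry

/-- **IDX (S): the torsor count** — under `SL2Onto`, `eqvSubgroup e` has index `≥ 120 = |SL₂(𝔽₅)|`
for EVERY additive iso `e : E_d[5] ≃ W[5]`: with a frame `e₁` of `W[5]` and `γ_M` (`M ∈ SL₂(𝔽₅)`)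
trivial on `E_d[5]` with `ρ̄(γ_M) = M`, the cosets `γ_M·(eqvSubgroup e)` are pairwise distinct
(`γ_{M'}⁻¹γ_M ∈ eqvSubgroup e` iff it acts trivially on `W[5] = e(E_d[5])` iff `M = M'`), so
`|SL₂(𝔽₅)| ≤ Nat.card (Γ ⧸ eqvSubgroup e)` (`Nat.card_le_card_of_injective`; `|GL₂(𝔽₅)| = 480`
`Matrix.card_GL_field`, `det` onto `𝔽₅ˣ` ⇒ `|SL₂(𝔽₅)| = 120`, or `decide`). [folklore] -/
theorem le_index_eqvSubgroup {c₄ c₆ : ℤ} {d : ℚ} (hbig : SL2Onto c₄ c₆ d)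
    (e : (Ed d).geomTorsion 5 ≃+ (base (c₄ : ℚ) c₆).geomTorsion 5) (hfin : (eqvSubgroup e).index ≠ 0) :
    120 ≤ (eqvSubgroup e).index := by
  sorry

/-- **TRANS (S): two symplectic isos differ by a Galois element trivial on `E_d[5]`** (under
`SL2Onto`).  Recipe: frame `(ρ, e₁)` of `W[5]` (`exists_isTorsionGaloisRep`); `g := e₀ ∘ e⁻¹` is a
symplectic automorphism of `W[5]`, its matrix `M` in `e₁` has `det M = 1` by W1
(`weilPairing_eq_pow_det_of_frame`: `e₅(gP,gQ) = ζ^{det M·[P,Q]} = e₅(P,Q) = ζ^{[P,Q]}`, `ζ` primitive,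
`IsPrimitiveRoot.pow_inj`); `SL2Onto` gives `γ` with `ρ̄(γ) = M`, `γ|_{E_d[5]} = 1`, and then
`γ • eP = e₁⁻¹(M·e₁(eP)) = g(eP) = e₀P`. [SilvermanAEC2009 III.8.1; folklore] -/
theorem exists_gal_of_symplectic_pair {c₄ c₆ : ℤ} {d : ℚ} [(base (c₄ : ℚ) c₆).IsElliptic]
    [(Ed d).IsElliptic] (hbig : SL2Onto c₄ c₆ d)
    (e e₀ : (Ed d).geomTorsion 5 ≃+ (base (c₄ : ℚ) c₆).geomTorsion 5)
    (he : IsSymplectic e) (he₀ : IsSymplectic e₀) :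
    ∃ γ : Field.absoluteGaloisGroup ℚ, (∀ P : (Ed d).geomTorsion 5, γ • P = P) ∧
      ∀ P : (Ed d).geomTorsion 5, e₀ P = γ • e P := by
  sorry

/-- **PINCH (PROVED): a subgroup of finite index contained in a subgroup of no smaller index is
equal to it.** -/
theorem eq_of_le_of_index_le {G : Type*} [Group G] {H K : Subgroup G} (hle : H ≤ K)
    (hH : H.index ≠ 0) (hidx : H.index ≤ K.index) : H = K := by
  have hdvd : K.index ∣ H.index := Subgroup.index_dvd_of_le hle
  have hle' : K.index ≤ H.index := Nat.le_of_dvd (Nat.pos_of_ne_zero hH) hdvd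
  have heq : K.index = H.index := le_antisymm hle' hidx
  have hK : K.index ≠ 0 := heq ▸ hH
  have hrel : H.relIndex K * K.index = H.index := Subgroup.relIndex_mul_index hle
  have h1 : H.relIndex K = 1 := by
    rw [← heq] at hrel
    have h1' : H.relIndex K * K.index = 1 * K.index := by rw [hrel, one_mul]
    exact Nat.eq_of_mul_eq_mul_right (Nat.pos_of_ne_zero hK) h1'
  exact le_antisymm hle (Subgroup.relIndex_eq_one.mp h1)

/-- **CONJ (PROVED): transporting the equivariance subgroup along `e₀ = γ ∘ e`** (`γ` trivial on the
source): `σ ∈ eqvSubgroup e₀ ↔ γ⁻¹σγ ∈ eqvSubgroup e`. -/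
theorem mem_eqvSubgroup_conj {E E' : WeierstrassCurve ℚ} (e e₀ : E'.geomTorsion 5 ≃+ E.geomTorsion 5)
    (γ : Field.absoluteGaloisGroup ℚ) (hγ : ∀ P : E'.geomTorsion 5, γ • P = P)
    (he₀ : ∀ P : E'.geomTorsion 5, e₀ P = γ • e P) (σ : Field.absoluteGaloisGroup ℚ) :
    σ ∈ eqvSubgroup e₀ ↔ γ⁻¹ * σ * γ ∈ eqvSubgroup e := by
  have hγ' : ∀ P : E'.geomTorsion 5, γ⁻¹ • P = P := fun P => by
    conv_lhs => rw [← hγ P]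
    rw [inv_smul_smul]
  rw [mem_eqvSubgroup_iff, mem_eqvSubgroup_iff]
  refine forall_congr' fun P => ?_
  rw [he₀, he₀, mul_smul, mul_smul, hγ P, hγ' (σ • P), mul_smul, mul_smul, eq_inv_smul_iff]

/-! ## §3 The composition — KERNEL-CHECKED from the named helpers

`Thm132iRootFibre` (R1, named) + `SL2Onto` (regime) + FIX + ROOT + ORB + IDX + TRANS + PINCH + CONJ
⟹ `Core1728At c₄ c₆`.  No `Thm132iiMemHesseFamily`, no G4c/G4c′, no `Split1728`. -/

/-- **`Core1728At` by torsor rigidity (PROVED modulo the sorried helpers; no Fisher (ii)).** -/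
theorem core1728At_of_rigidity (hR1 : Thm132iRootFibre) (c₄ c₆ : ℤ) (hc : c₄ ^ 3 ≠ c₆ ^ 2)
    (h6 : c₆ ≠ 0) [(base (c₄ : ℚ) c₆).IsElliptic]
    (hbig : ∀ d : ℚ, (d = 1 ∨ d = 9 ∨ d = -3) → SL2Onto c₄ c₆ d) : Core1728At c₄ c₆ := by
  obtain ⟨τ, d, hEd, hd, hs, hz, e₀, he₀, hτ⟩ := exists_aux_fixed c₄ c₆
  have hd0 : d ≠ 0 := by rcases hd with rfl | rfl | rfl <;> norm_num
  obtain ⟨t₁, ht6, ht4⟩ := exists_goodRoot c₄ c₆ hc h6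
  -- a fourth root `w` with `d·w⁴ = −27𝔠₄(t₁,1)`: `E_{t₁,1} ≅ E_d` over `ℚ(t₁, w)`
  obtain ⟨w, hw⟩ : ∃ w : AlgebraicClosure ℚ,
      (d : AlgebraicClosure ℚ) * w ^ 4 = -27 * C4 (c₄ : AlgebraicClosure ℚ) c₆ t₁ 1 := by
    have hd0' : (d : AlgebraicClosure ℚ) ≠ 0 := by exact_mod_cast hd0
    obtain ⟨w, hw⟩ := IsAlgClosed.exists_pow_nat_eq
      ((-27 * C4 (c₄ : AlgebraicClosure ℚ) c₆ t₁ 1) / d) (by norm_num : 0 < 4)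
    exact ⟨w, by rw [hw, mul_div_cancel₀ _ hd0']⟩
  -- R1: Fisher 13.2 (⇐) over `ℚ(t₁, w)`
  obtain ⟨e, he, hstab⟩ := hR1 c₄ c₆ d t₁ w ht6 ht4 hw
  -- TRANS: `e₀ = γ ∘ e`, `γ` trivial on `E_d[5]`
  obtain ⟨γ, hγ, hγe⟩ := exists_gal_of_symplectic_pair (hbig d hd) e e₀ he he₀
  -- the index pinch `Stab(t₁, w) = eqvSubgroup e`
  have hle : MulAction.stabilizer (Field.absoluteGaloisGroup ℚ)
      ((t₁, w) : AlgebraicClosure ℚ × AlgebraicClosure ℚ) ≤ eqvSubgroup e := by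
    intro σ hσ
    have h := MulAction.mem_stabilizer_iff.mp hσ
    rw [Prod.smul_mk, Prod.mk.injEq] at h
    exact hstab σ h.1 h.2
  obtain ⟨hH0, hH120⟩ := index_stabilizer_pair_le (c₄ := c₄) hd0 h6 ht6 hw
  have hK0 : (eqvSubgroup e).index ≠ 0 := fun h0 =>
    hH0 (Nat.eq_zero_of_zero_dvd (h0 ▸ Subgroup.index_dvd_of_le hle))
  have hK120 : 120 ≤ (eqvSubgroup e).index := le_index_eqvSubgroup (hbig d hd) e hK0
  have hHK : MulAction.stabilizer (Field.absoluteGaloisGroup ℚ)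
      ((t₁, w) : AlgebraicClosure ℚ × AlgebraicClosure ℚ) = eqvSubgroup e :=
    eq_of_le_of_index_le hle hH0 (hH120.trans hK120)
  -- `τ ∈ eqvSubgroup e₀ = γ (eqvSubgroup e) γ⁻¹`: `γ⁻¹τγ` fixes `(t₁, w)`, so `τ` fixes `γ • t₁`
  have hmem : γ⁻¹ * τ * γ ∈ MulAction.stabilizer (Field.absoluteGaloisGroup ℚ)
      ((t₁, w) : AlgebraicClosure ℚ × AlgebraicClosure ℚ) := by
    rw [hHK]
    exact (mem_eqvSubgroup_conj e e₀ γ hγ hγe τ).mp hτ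
  have hfix := MulAction.mem_stabilizer_iff.mp hmem
  have ht : τ • (γ • t₁) = γ • t₁ := by
    have h1 := congr_arg Prod.fst hfix
    simp only [Prod.smul_fst, mul_smul] at h1
    rwa [inv_smul_eq_iff] at h1
  obtain ⟨h6', h4'⟩ := goodRoot_smul γ ht6 ht4
  exact ⟨τ, γ • t₁, hs, hz, h6', h4', ht⟩

/-- **The gen-8 CORE in the big-image regime** (what `stub_switch_of_core_and_tail` consumes,
pointwise at the integral model `base(c₄,c₆) ≅_ℚ W`). -/
def Core1728Big : Prop :=
  ∀ (c₄ c₆ : ℤ), c₄ ^ 3 ≠ c₆ ^ 2 → c₆ ≠ 0 → ∀ [(base (c₄ : ℚ) c₆).IsElliptic],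
    HasSL2 c₄ c₆ → Core1728At c₄ c₆

/-- **PROVED modulo R1 (named), R2′ (M), and the S/M− helpers above.** -/
theorem core1728Big_of_rigidity (hR1 : Thm132iRootFibre) : Core1728Big := by
  intro c₄ c₆ hc h6 hinst hSL
  haveI := hinst
  refine core1728At_of_rigidity hR1 c₄ c₆ hc h6 fun d hd => ?_
  have hEd : (Ed d).IsElliptic := by
    rcases hd with rfl | rfl | rfl <;>
      exact ⟨isUnit_iff_ne_zero.mpr (by norm_num [Ed, WeierstrassCurve.Δ, WeierstrassCurve.b₂,
        WeierstrassCurve.b₄, WeierstrassCurve.b₆, WeierstrassCurve.b₈])⟩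
  exact sl2Onto_of_hasSL2 c₄ c₆ d hSL

/-! ## §4 BOUNDARY (family 3): where rigidity provably fails

Transitivity on the `120`-element torsor needs `5 ∣ #ρ̄_{W,5}(Γ_ℚ)`; the CM/normaliser/`S₄` images have
order dividing `2⁷·3`.  Kit j345070 (PARI, one batched job): factor degrees of `𝔠₆(c₄,c₆;T,1) ∈ ℚ[T]`
— `[30]` for `37a1, 43a1, 14a1, y²=x(x−1)(x+8)`; `[6,12,12]` for `36a1, 27a1, 49a1`; `[2,4,8,8,8]` for
`11a1`; `gcd(𝔠₆, 𝔠₄)(T,1) = 1` and `𝔠₆(T,1)` squarefree in all eight.  Arithmetic shadow only: -/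
example : ¬ 5 ∣ (2 ^ 7 * 3 : ℕ) ∧ (6 + 12 + 12 = 30) ∧ (2 + 4 + 8 + 8 + 8 = 30) := by decide

/-! ## §5 Sanity: the target is literally the stub -/

example : CDT_three_five_switch ↔
    (∀ (W : WeierstrassCurve ℚ) [W.IsElliptic], ¬ 27 ∣ W.conductorNorm ℤ →
      (∀ ρ₃ : ModPGaloisRep ℚ (ZMod 3) 2, W.IsTorsionGaloisRep 3 ρ₃ → ¬ ρ₃.IsAbsIrreducibleOverSqrt (-3)) →
      ∀ (ρ : ModPGaloisRep ℚ (ZMod 5) 2), W.IsTorsionGaloisRep 5 ρ → ρ.IsAbsIrreducibleOverSqrt 5 →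
        ∃ (W' : WeierstrassCurve ℚ) (_ : W'.IsElliptic), W'.IsTorsionGaloisRep 5 ρ ∧
          ∃ ρ₃' : ModPGaloisRep ℚ (ZMod 3) 2, W'.IsTorsionGaloisRep 3 ρ₃' ∧
            ρ₃'.IsAbsIrreducibleOverSqrt (-3)) := Iff.rfl

end Summit.ABC.ABC.Cruxes.FreyModularity.StubSwitchK3g8
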